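import Mathlib
import HarnessLib

/-!
# Quadratic energy gap at a critical point from a second-derivative lower bound (one variable)

Topic `Literature/Analysis/Calculus`.  The one-dimensional calculus fact behind "a critical point of a strongly convex
energy is its minimiser, with a quadratic gap": if `f : ℝ → ℝ` has `f″ ≥ m` on `[0, 1]` and `f′(0) = 0`, then
`f 1 − f 0 ≥ m / 2` (and `f′ t ≥ m t` on `[0,1]`).  Applied to `t ↦ E(u + t v)` along a segment from a critical point `u`
of an energy `E` whose second variation along the segment is `≥ m = κ‖v‖²`, it gives `E(u + v) − E(u) ≥ κ‖v‖²/2` — the form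
in which tube coercivity of the Lennard-Jones Hessian turns force-balanced regions into minimisers for their own exterior
data (crux `NashNearField`, stmt-AtomisticToContinuum-16827, stub `stub_flatnessOfTubeCoercivity`).  Mathlib has
`StrongConvexOn` but no derivative characterisation; we argue directly with `monotoneOn_of_deriv_nonneg`. [folklore]

* `deriv_ge_mul_of_deriv2_ge` — `f′ t ≥ m t` for `t ∈ [0,1]`;
* `sub_ge_half_of_deriv2_ge` — `m / 2 ≤ f 1 − f 0`.
-/

noncomputable section

open Set

namespace Literature.Analysis.Calculus

variable {f f' f'' : ℝ → ℝ} {m : ℝ}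

/-- If `f′` has derivative `f″ ≥ m` on `[0,1]` and `f′ 0 = 0`, then `f′ t ≥ m t` on `[0,1]` (the function
`t ↦ f′ t − m t` is monotone). [folklore] -/
theorem deriv_ge_mul_of_deriv2_ge (hf' : ∀ t ∈ Icc (0 : ℝ) 1, HasDerivAt f' (f'' t) t) (h0 : f' 0 = 0)
    (hm : ∀ t ∈ Icc (0 : ℝ) 1, m ≤ f'' t) {t : ℝ} (ht : t ∈ Icc (0 : ℝ) 1) : m * t ≤ f' t := by
  -- `g t = f' t - m t` is monotone on `[0,1]`
  have hg : ∀ s ∈ Icc (0 : ℝ) 1, HasDerivAt (fun s => f' s - m * s) (f'' s - m) s := fun s hs =>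
    (hf' s hs).sub ((hasDerivAt_id s).const_mul m |>.congr_deriv (by simp))
  have hmono : MonotoneOn (fun s => f' s - m * s) (Icc (0 : ℝ) 1) := by
    refine monotoneOn_of_deriv_nonneg (convex_Icc 0 1) ?_ ?_ ?_
    · exact fun s hs => (hg s hs).continuousAt.continuousWithinAt
    · intro s hs
      rw [interior_Icc] at hs
      exact (hg s (Ioo_subset_Icc_self hs)).differentiableAt.differentiableWithinAt
    · intro s hs
      rw [interior_Icc] at hs
      rw [(hg s (Ioo_subset_Icc_self hs)).deriv]
      linarith [hm s (Ioo_subset_Icc_self hs)]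
  have h := hmono (left_mem_Icc.2 zero_le_one) ht ht.1
  simp only [mul_zero, sub_zero, h0] at h
  linarith

/-- **Quadratic gap at a critical point.**  If `f` has derivative `f′` and `f′` has derivative `f″ ≥ m` on `[0,1]`, and
`f′ 0 = 0`, then `m / 2 ≤ f 1 − f 0`. [folklore] -/
theorem sub_ge_half_of_deriv2_ge (hf : ∀ t ∈ Icc (0 : ℝ) 1, HasDerivAt f (f' t) t)
    (hf' : ∀ t ∈ Icc (0 : ℝ) 1, HasDerivAt f' (f'' t) t) (h0 : f' 0 = 0)
    (hm : ∀ t ∈ Icc (0 : ℝ) 1, m ≤ f'' t) : m / 2 ≤ f 1 - f 0 := by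
  -- `h t = f t - f 0 - m t² / 2` is monotone on `[0,1]`
  have hh : ∀ s ∈ Icc (0 : ℝ) 1, HasDerivAt (fun s => f s - f 0 - m * s ^ 2 / 2) (f' s - m * s) s := by
    intro s hs
    have h1 : HasDerivAt (fun s => m * s ^ 2 / 2) (m * s) s := by
      have := ((hasDerivAt_pow 2 s).const_mul m).div_const 2
      refine this.congr_deriv ?_
      push_cast
      ring
    exact ((hf s hs).sub_const (f 0)).sub h1
  have hmono : MonotoneOn (fun s => f s - f 0 - m * s ^ 2 / 2) (Icc (0 : ℝ) 1) := by
    refine monotoneOn_of_deriv_nonneg (convex_Icc 0 1) ?_ ?_ ?_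
    · exact fun s hs => (hh s hs).continuousAt.continuousWithinAt
    · intro s hs
      rw [interior_Icc] at hs
      exact (hh s (Ioo_subset_Icc_self hs)).differentiableAt.differentiableWithinAt
    · intro s hs
      rw [interior_Icc] at hs
      rw [(hh s (Ioo_subset_Icc_self hs)).deriv]
      linarith [deriv_ge_mul_of_deriv2_ge hf' h0 hm (Ioo_subset_Icc_self hs)]
  have h := hmono (left_mem_Icc.2 zero_le_one) (right_mem_Icc.2 zero_le_one) zero_le_one
  simp only at h
  norm_num at h
  linarith

end Literature.Analysis.Calculus

end
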